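import Summits.Langlands.Langlands.Theses.PolarisationCarving

/-!
# PolarisationCarving — glue of the layer-1 split (k = 3) of `PolarisedTypeAutomorphy`

Closes the glue item stmt-Langlands-33823
`PolarisationCarving.PolarisedTypeAutomorphy_of_split :
  GappedIrregularPolarisedAutomorphy → GapFreeIrregularPolarisedAutomorphy → RegularPolarisedAutomorphy → PolarisedTypeAutomorphy`
(route-Langlands-PolarisationCarving rev 6; lens-6-g12 node `PolarisedGapCarving`, crit-1 g4 row 143).  NOTE the gate rendered the
antecedents in rank order PGP → PGF → PR (the lens's mock had PR → PGF → PGP); the proof below binds them in the rendered order.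

Pure logic: two excluded middles — on the inlined regularity dial REG and, inside ¬REG, on the gap-free dial GF — written with
`by_contra` so that NO dial is restated (the negated dials are the `fun h => hno (…)` terms, typed by the children's binders).
Plus the exactness statement POL ↔ PR ∧ PGF ∧ PGP.  No definitions, no new mathematics.
-/

set_option linter.dupNamespace false -- project-wide option; `Summit.Langlands.Langlands` is the mandated namespace

namespace Summit.Langlands.Langlands.Theorems

open Summit.Langlands.Langlands.Theses

/-- The split glue PGP → PGF → PR → POL. -/
theorem PolarisedTypeAutomorphy_of_split_proof : PolarisationCarving.PolarisedTypeAutomorphy_of_split := by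
  intro hPGP hPGF hPR K _ _ n hcpt hn ℓ _ ι ρ hirr hgeo htw hpol
  by_contra hno
  refine hno (hPGP K n hcpt hn ℓ ι ρ hirr hgeo htw ⟨hpol, fun hr => hno ?g1, fun hg => hno ?g2⟩)
  case g1 => exact hPR K n hcpt hn ℓ ι ρ hirr hgeo htw ⟨hpol, hr⟩
  case g2 =>
    exact hPGF K n hcpt hn ℓ ι ρ hirr hgeo htw
      ⟨hpol, fun hr => hno (hPR K n hcpt hn ℓ ι ρ hirr hgeo htw ⟨hpol, hr⟩), hg⟩

/-- … and conversely: POL ⟺ PR ∧ PGF ∧ PGP (the split is exact; each cell is POL restricted to a sub-box). -/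
theorem PolarisedTypeAutomorphy_split_exact :
    PolarisationCarving.PolarisedTypeAutomorphy ↔
      (PolarisationCarving.RegularPolarisedAutomorphy ∧ PolarisationCarving.GapFreeIrregularPolarisedAutomorphy ∧
        PolarisationCarving.GappedIrregularPolarisedAutomorphy) := by
  refine ⟨fun h => ⟨?_, ?_, ?_⟩, fun h => PolarisedTypeAutomorphy_of_split_proof h.2.2 h.2.1 h.1⟩
  · intro K _ _ n hcpt hn ℓ _ ι ρ hirr hgeo htw hc
    exact h K n hcpt hn ℓ ι ρ hirr hgeo htw hc.1
  · intro K _ _ n hcpt hn ℓ _ ι ρ hirr hgeo htw hc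
    exact h K n hcpt hn ℓ ι ρ hirr hgeo htw hc.1
  · intro K _ _ n hcpt hn ℓ _ ι ρ hirr hgeo htw hc
    exact h K n hcpt hn ℓ ι ρ hirr hgeo htw hc.1

end Summit.Langlands.Langlands.Theorems
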